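import Literature.AnabelianGeometry.SemiGraphs.OneVertexWitnessChart
import Literature.AnabelianGeometry.SemiGraphs.TemperedSpecialFibreTower
import Literature.AnabelianGeometry.SemiGraphs.CharacteristicOpenCore
import HarnessLib

/-!
# Special-fibre towers over ANY slim profinite group with characteristic levels
# ([SemiAnbd] Example 3.10, pp. 44–45 — non-vacuity of the interface `SpecialFibreTower`, generic form)

Mochizuki, *Semi-graphs of anabelioids*, Publ. RIMS **42** (2006), §3, Example 3.10, manuscript p. 44
[cite: MochizukiSemiAnbd2006, Ex 3.10 p.44] ("an exhaustive sequence of open characteristic [hence normal]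
subgroups of finite index … `⊆ N_i ⊆ … ⊆ Δ` … semi-graphs of anabelioids `𝒢_i` … `Δ ↠ … ↠ Δ[i] :=
π₁^temp(𝒢_i) ⋊^out Δ_i ↠ …`") — typed by seat abc-iut-w5-d122 as the INTERFACE structure `SpecialFibreTower Δ`
(`TemperedSpecialFibreTower.lean`) over the [SemiAnbd] §3 interface of seat abc-iut-L3-t2.

PROOF-ONLY file (abc-iut cell §4(iii) non-vacuity lane; seat abc-iut-L3-t2 gen 4; no definition, no instance, no
named fact).  Seat abc-iut-L3-t2 gen 3's `TemperedSpecialFibreTowerNonVacuity.lean` inhabits `SpecialFibreTower Δ` at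
the ONE group `Δ := Aff(ℤ_p)` (`p` odd).  Here the same one-vertex construction is carried out GENERICALLY:

* `ProfiniteSemiGraph.LevelFamily.nonempty_of_infinite` — EVERY infinite, first-countable profinite group `P`
  carries a `LevelFamily` (seat abc-iut-L3-t2 gen 3's witness datum: open normal subgroups with finite quotients of
  unbounded order forming a basis of neighbourhoods of `1`; Def. 2.3 (iii) / Def. 2.4 (i) / [IUTchI] Rmk. 2.5.3 (i)
  (T2) for the one-vertex semi-graph of anabelioids `B(P)`);
* `SpecialFibreTower.exists_of_charLevels` — for EVERY profinite, slim, infinite, second-countable `Δ` and EVERY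
  antitone exhaustive family `N` of open normal finite-index subgroups stable under all automorphisms of the
  topological group `Δ` ("open characteristic … of finite index … exhaustive", p. 44 l. 9–11 — exactly the printed
  requirements), there is a `SpecialFibreTower Δ` WITH LEVELS `N`: `𝒢_i :=` the one-vertex edgeless semi-graph of
  anabelioids `B(N_i)` (seat abc-iut-L3-t2's `OneVertex.graph`, satisfying the hypotheses of Thm. 3.7 because `N_i`
  is slim with a level family), `π₁^temp(𝒢_i) = N_i` ON THE NOSE (`OneVertex.chart`), admissible quotient the
  identity (`admKer i = 1`, so `Δ[i] = Δ`), faithfulness = slimness of `Δ`; the whole group is verticial;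
* `SpecialFibreTower.exists_of_isTopologicallyFinitelyGenerated` — in particular for every TOPOLOGICALLY FINITELY
  GENERATED such `Δ`, with the prescribed CHARACTERISTIC OPEN CORES `N_i := charOpenCore Δ i` of seat
  abc-iut-w4-d053 (`charOpenCore_family_of_tfg`: Dixon–du Sautoy–Mann–Segal Prop. 1.6), which are moreover COFINAL
  among the open subgroups of finite index (the reading `PiData.N_cofinal` of "exhaustive").

HONEST LIMITS: consistency evidence for the field set of `SpecialFibreTower` only — the fibres are one-vertex
semi-graphs of anabelioids, not special fibres of curves; the origin statement `Ex310TowerStatement` / the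
certificate `SpecialFibreOrigin.IsSpecialFibreOf` are NOT claimed; `Δ` is profinite here whereas a genuine
`Δ^temp_X` is not.  No statement of the paper is asserted; nothing here bears on [IUTchIII] Cor. 3.12.
-/

noncomputable section

namespace Literature.AnabelianGeometry.SemiGraphs

open Literature.AlgebraicGeometry.Frobenioids (IsSlimGroup)
open Literature.AnabelianGeometry.AbsoluteAnabelian (IsTopologicallyFinitelyGenerated)
open ProfiniteSemiGraph Topology Filter

universe u

/-! ### Level families exist on every infinite first-countable profinite group -/

namespace ProfiniteSemiGraph.LevelFamily

variable (P : Type u) [Group P] [TopologicalSpace P] [IsTopologicalGroup P] [CompactSpace P]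
  [TotallyDisconnectedSpace P]

omit [IsTopologicalGroup P] [CompactSpace P] in
/-- In an infinite profinite group, every finite set of elements is separated by some open normal subgroup lying in
a prescribed neighbourhood basis: given an antitone basis `N` of open normal subgroups and `M : ℕ`, some quotient
`P / N_n` has at least `M` elements. [cite: MochizukiSemiAnbd2006, Def 2.4(i) p.25] -/
theorem exists_le_card_quotient [Infinite P] (N : ℕ → Subgroup P)
    (hbasis : ∀ U : Set P, IsOpen U → (1 : P) ∈ U → ∃ n, (N n : Set P) ⊆ U)
    (hfin : ∀ n, Finite (P ⧸ N n)) (M : ℕ) : ∃ n, M ≤ Nat.card (P ⧸ N n) := by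
  classical
  obtain ⟨s, hs⟩ := Infinite.exists_subset_card_eq P M
  -- the finitely many quotients `x⁻¹ y`, `x ≠ y` in `s`, avoid some `N_n`
  let D : Set P := (fun q : P × P => q.1⁻¹ * q.2) '' {q : P × P | q.1 ∈ s ∧ q.2 ∈ s ∧ q.1 ≠ q.2}
  have hDfin : D.Finite := by
    refine Set.Finite.image _ ?_
    exact Set.Finite.subset ((s.finite_toSet.prod s.finite_toSet)) fun q hq => ⟨hq.1, hq.2.1⟩
  have h1D : (1 : P) ∉ D := by
    rintro ⟨q, ⟨-, -, hne⟩, hq⟩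
    exact hne (inv_mul_eq_one.mp hq)
  obtain ⟨n, hn⟩ := hbasis Dᶜ hDfin.isClosed.isOpen_compl h1D
  refine ⟨n, ?_⟩
  haveI := hfin n
  have hinj : Function.Injective fun x : s => (QuotientGroup.mk (x : P) : P ⧸ N n) := by
    intro x y hxy
    by_contra hne
    have hmem : (x : P)⁻¹ * (y : P) ∈ N n := QuotientGroup.eq.mp hxy
    have : (x : P)⁻¹ * (y : P) ∈ D :=
      ⟨((x : P), (y : P)), ⟨x.2, y.2, fun h => hne (Subtype.ext h)⟩, rfl⟩
    exact hn hmem this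
  calc M = Nat.card s := by rw [Nat.card_eq_fintype_card, Fintype.card_coe, hs]
    _ ≤ Nat.card (P ⧸ N n) := Nat.card_le_card_of_injective _ hinj

/-- **Every infinite first-countable profinite group carries a level family** (open normal subgroups with finite
quotients of unbounded order, every neighbourhood of `1` containing one of them) — the datum that makes the
one-vertex semi-graph of anabelioids `B(P)` quasi-coherent, totally elevated and Galois-countable.
[cite: MochizukiSemiAnbd2006, Def 2.3 pp.24-25] -/
theorem nonempty_of_infinite [FirstCountableTopology P] [Infinite P] : Nonempty (LevelFamily P) := by
  obtain ⟨u, hu⟩ := (𝓝 (1 : P)).exists_antitone_basis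
  -- an open normal subgroup inside each basic neighbourhood
  have hH : ∀ n, ∃ H : OpenNormalSubgroup P, (H : Set P) ⊆ u n := fun n => by
    obtain ⟨t, htu, hto, h1t⟩ := mem_nhds_iff.mp (hu.mem n)
    obtain ⟨H, hH⟩ := ProfiniteGrp.exist_openNormalSubgroup_sub_open_nhds_of_one hto h1t
    exact ⟨H, hH.trans htu⟩
  choose H hHu using hH
  have hopen : ∀ n, IsOpen ((H n).toSubgroup : Set P) := fun n => (H n).isOpen
  have hfin : ∀ n, Finite (P ⧸ (H n).toSubgroup) := fun n =>
    Subgroup.quotient_finite_of_isOpen _ (hopen n)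
  have hbasis : ∀ U : Set P, IsOpen U → (1 : P) ∈ U → ∃ n, ((H n).toSubgroup : Set P) ⊆ U :=
    fun U hU h1 => by
      obtain ⟨n, hn⟩ := hu.mem_iff.mp (hU.mem_nhds h1)
      exact ⟨n, (hHu n).trans hn⟩
  exact ⟨{ N := fun n => (H n).toSubgroup
           normal := fun n => inferInstance
           isOpen := hopen
           finiteQuotient := hfin
           basis := hbasis
           unbounded := exists_le_card_quotient P (fun n => (H n).toSubgroup) hbasis hfin }⟩

end ProfiniteSemiGraph.LevelFamily

/-! ### Small group-theoretic facts -/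

/-- Open subgroups of slim groups are slim (private copy of seat abc-iut-L3-t2 gen 3's lemma; [SemiAnbd] §0 p. 6
"slim"). [cite: MochizukiSemiAnbd2006, §0 p.6] -/
private theorem isSlimGroup_subgroup {G : Type u} [Group G] [TopologicalSpace G] [ContinuousMul G]
    (hG : IsSlimGroup G) (H : Subgroup G) (hH : IsOpen (H : Set G)) : IsSlimGroup H := by
  refine ⟨fun U hU => ?_⟩
  have hUo : IsOpen ((U.map H.subtype : Subgroup G) : Set G) := by
    have : ((U.map H.subtype : Subgroup G) : Set G) = Subtype.val '' (U : Set H) := by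
      ext x; simp
    rw [this]
    exact hH.isOpenMap_subtype_val _ hU
  have hc := hG.centralizer_eq_bot _ hUo
  refine (Subgroup.eq_bot_iff_forall _).mpr fun c hc' => ?_
  have hcG : (c : G) ∈ Subgroup.centralizer ((U.map H.subtype : Subgroup G) : Set G) := by
    rw [Subgroup.mem_centralizer_iff]
    rintro _ ⟨u, hu, rfl⟩
    exact congrArg Subtype.val (Subgroup.mem_centralizer_iff.mp hc' u hu)
  rw [hc] at hcG
  exact Subtype.ext (Subgroup.mem_bot.mp hcG)

/-- A subgroup of finite index of an infinite group is infinite. [folklore] -/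
private theorem infinite_of_finiteIndex {G : Type u} [Group G] [Infinite G] (H : Subgroup G) [H.FiniteIndex] :
    Infinite H := by
  by_contra hfin
  rw [not_infinite_iff_finite] at hfin
  have hcard : Nat.card G = H.index * Nat.card H := (Subgroup.index_mul_card H).symm
  have hne : Nat.card G ≠ 0 := by
    rw [hcard]
    exact mul_ne_zero Subgroup.FiniteIndex.index_ne_zero (Nat.card_pos (α := H)).ne'
  haveI := Nat.finite_of_card_ne_zero hne
  exact not_finite G

/-- An open subgroup of a compact group is compact. [folklore] -/
private theorem compactSpace_subgroup {G : Type u} [Group G] [TopologicalSpace G] [ContinuousMul G]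
    [CompactSpace G] (H : Subgroup G) (hH : IsOpen (H : Set G)) : CompactSpace H :=
  isCompact_iff_compactSpace.mp (H.isClosed_of_isOpen hH).isCompact

/-- In a profinite group, a family of subgroups that is COFINAL among the open subgroups of finite index is
EXHAUSTIVE in the sense of [SemiAnbd] Ex. 3.10 p. 44 l. 9 ("an exhaustive sequence of open … subgroups of finite
index"): its intersection is trivial (the open normal subgroups of a profinite group separate points).
[cite: MochizukiSemiAnbd2006, Ex 3.10 p.44] -/
theorem eq_one_of_forall_mem_of_cofinal {Δ : Type u} [Group Δ] [TopologicalSpace Δ] [IsTopologicalGroup Δ]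
    [CompactSpace Δ] [TotallyDisconnectedSpace Δ] (N : ℕ → Subgroup Δ)
    (hcof : ∀ U : Subgroup Δ, IsOpen (U : Set Δ) → U.FiniteIndex → ∃ i, N i ≤ U) (g : Δ)
    (hg : ∀ i, g ∈ N i) : g = 1 := by
  by_contra hne
  obtain ⟨H, hH⟩ := ProfiniteGrp.exist_openNormalSubgroup_sub_open_nhds_of_one
    (isOpen_compl_singleton (x := g)) (by simpa using fun h : (1 : Δ) = g => hne h.symm)
  haveI : Finite (Δ ⧸ H.toSubgroup) := Subgroup.quotient_finite_of_isOpen _ H.isOpen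
  haveI : H.toSubgroup.FiniteIndex := Subgroup.finiteIndex_of_finite_quotient
  obtain ⟨i, hi⟩ := hcof H.toSubgroup H.isOpen inferInstance
  exact hH (hi (hg i)) rfl

/-! ### The tower over a slim profinite group with characteristic levels -/

namespace SpecialFibreTower

variable {Δ : Type u} [Group Δ] [TopologicalSpace Δ] [IsTopologicalGroup Δ] [CompactSpace Δ]
  [TotallyDisconnectedSpace Δ] [SecondCountableTopology Δ]

/-- **NON-VACUITY of `SpecialFibreTower` over ANY slim infinite second-countable profinite group with
characteristic levels** ([SemiAnbd] Ex. 3.10 p. 44 as typed): given an antitone exhaustive family `N` of open normal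
finite-index subgroups of `Δ` stable under every automorphism of the topological group `Δ`, there is a special-fibre
tower WITH LEVELS `N` whose fibre `𝒢_i` is the GENUINE one-vertex semi-graph of anabelioids `B(N_i)` (hypotheses
of Thm. 3.7 from the slimness of `N_i` and a level family), with explicit chart `π₁^temp(𝒢_i) = N_i`, admissible
quotient the identity (kernel `1`), faithfulness from the slimness of `Δ`; and in every fibre the whole chart group
is a verticial subgroup.  Consistency evidence only (no origin certificate; not the tower of a curve).
[cite: MochizukiSemiAnbd2006, Ex 3.10 p.44] -/
theorem exists_of_charLevels [Infinite Δ] (hslim : IsSlimGroup Δ) (N : ℕ → Subgroup Δ) (hanti : Antitone N)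
    (hopen : ∀ i, IsOpen (N i : Set Δ))
    (hchar : ∀ (i) (φ : Δ ≃ₜ* Δ), (N i).map φ.toMulEquiv.toMonoidHom = N i)
    (hnormal : ∀ i, (N i).Normal) (hfi : ∀ i, (N i).FiniteIndex) (hexh : ∀ g : Δ, (∀ i, g ∈ N i) → g = 1) :
    ∃ T : SpecialFibreTower Δ, T.N = N ∧ (∀ i, T.admKer i = ⊥) ∧
      (∀ i, (T.Gc i).graph = OneVertex.ptSemiGraph) ∧
      ∀ (i) (v : (T.Gc i).graph.Vertex), (⊤ : Subgroup (T.chart i).G) ∈ verticialSubgroups (T.chart i) v := by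
  haveI hcpt : ∀ i : ℕ, CompactSpace (N i) := fun i => compactSpace_subgroup (N i) (hopen i)
  haveI hsc : ∀ i : ℕ, SecondCountableTopology (N i) :=
    fun i => TopologicalSpace.Subtype.secondCountableTopology _
  haveI hinf : ∀ i : ℕ, Infinite (N i) := fun i => infinite_of_finiteIndex (N i)
  have hslimN : ∀ i : ℕ, IsSlimGroup (N i) := fun i => isSlimGroup_subgroup hslim (N i) (hopen i)
  have L : ∀ i : ℕ, ProfiniteSemiGraph.LevelFamily (N i) :=
    fun i => Classical.choice (ProfiniteSemiGraph.LevelFamily.nonempty_of_infinite (N i))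
  refine ⟨{ N := N
            N_antitone := hanti
            isOpen_N := hopen
            N_char := hchar
            N_normal := hnormal
            N_finiteIndex := hfi
            N_exhaustive := hexh
            Gc := fun i => OneVertex.graph (N i)
            hyp := fun i => OneVertex.thm37Hypotheses (L i) (hslimN i)
            chart := fun i => OneVertex.chart (L i)
            admKer := fun _ => ⊥
            admKer_le := fun _ => bot_le
            admKer_normal := fun _ => inferInstance
            admKer_antitone := fun _ _ _ => le_rfl
            adm := fun i => ContinuousMonoidHom.id _
            adm_surjective := fun i => Function.surjective_id
            isOpenMap_adm := fun i => IsOpenMap.id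
            ker_adm := fun i => ?_
            faithful := fun i g hg => ?_ }, rfl, fun _ => rfl, fun _ => rfl,
          fun i v => OneVertex.top_mem_verticialSubgroups (L i) v⟩
  · -- `Ker id = 1 = 1 ∩ N_i`
    rw [Subgroup.bot_subgroupOf]
    exact (MonoidHom.ker_eq_bot_iff _).mpr Function.injective_id
  · -- an element centralising the open `N_i` is trivial (slimness of `Δ`), so lies in `N_i`
    have hz : g ∈ Subgroup.centralizer (N i : Set Δ) := by
      rw [Subgroup.mem_centralizer_iff]
      intro n hn
      have h := hg n hn
      rw [Subgroup.mem_bot] at h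
      have : g * n = n * g := by
        calc g * n = g * n * g⁻¹ * n⁻¹ * (n * g) := by group
          _ = n * g := by rw [h, one_mul]
      exact this.symm
    rw [hslim.centralizer_eq_bot _ (hopen i), Subgroup.mem_bot] at hz
    rw [hz]; exact (N i).one_mem

/-- **NON-VACUITY of `SpecialFibreTower` over ANY slim infinite second-countable TOPOLOGICALLY FINITELY GENERATED
profinite group** — with the PRESCRIBED levels `N_i := charOpenCore Δ i` (the intersection of all open subgroups of
index `≤ i`: open, normal, of finite index, fixed by every bi-continuous automorphism, seat abc-iut-w4-d053's
`charOpenCore_family_of_tfg`), which are moreover COFINAL among the open subgroups of finite index (hence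
exhaustive).  One-vertex fibres `B(N_i)`, charts `π₁^temp = N_i`, admissible kernels `1`.  Consistency evidence only.
[cite: MochizukiSemiAnbd2006, Ex 3.10 p.44] -/
theorem exists_of_isTopologicallyFinitelyGenerated [Infinite Δ] (hslim : IsSlimGroup Δ)
    (htfg : IsTopologicallyFinitelyGenerated Δ) :
    ∃ T : SpecialFibreTower Δ, T.N = charOpenCore Δ ∧ (∀ i, T.admKer i = ⊥) ∧
      (∀ i, (T.Gc i).graph = OneVertex.ptSemiGraph) ∧
      (∀ (i) (v : (T.Gc i).graph.Vertex), (⊤ : Subgroup (T.chart i).G) ∈ verticialSubgroups (T.chart i) v) ∧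
      ∀ U : Subgroup Δ, IsOpen (U : Set Δ) → U.FiniteIndex → ∃ i, T.N i ≤ U := by
  obtain ⟨hanti, hlev, hcof⟩ := charOpenCore_family_of_tfg (Γ := Δ) htfg
  have hchar : ∀ (i) (φ : Δ ≃ₜ* Δ), (charOpenCore Δ i).map φ.toMulEquiv.toMonoidHom = charOpenCore Δ i :=
    fun i φ => (hlev i).2.2.2 φ.toMulEquiv φ.continuous φ.symm.continuous
  obtain ⟨T, hTN, hadm, hGc, htop⟩ := exists_of_charLevels hslim (charOpenCore Δ) hanti
    (fun i => (hlev i).1) hchar (fun i => (hlev i).2.1) (fun i => (hlev i).2.2.1)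
    (eq_one_of_forall_mem_of_cofinal (charOpenCore Δ) hcof)
  refine ⟨T, hTN, hadm, hGc, htop, fun U hU hUf => ?_⟩
  rw [hTN]; exact hcof U hU hUf

end SpecialFibreTower

end Literature.AnabelianGeometry.SemiGraphs

end
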